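import Summits.Langlands.Langlands.Theses.QuarterDeficit1951
import Literature.NumberTheory.GaloisRepresentations.GaloisRepUnramifiedProofs
import Literature.NumberTheory.GaloisRepresentations.TateUnramifiedLiftingHolds
import Literature.NumberTheory.GaloisRepresentations.DirichletCharacterOfGaloisCharacter
import Literature.FieldTheory.AlgClosed.PadicAlgClEquivComplex
import Literature.NumberTheory.Automorphic.BCDTTheoremBWildAtThreeDet
import Summits.Langlands.Langlands.Theorems.QuarterDeficit1951IcosahedralSupplyStubDmGaloisDatum
import Summits.Langlands.Langlands.Theorems.QuarterDeficit1951IcosahedralSupplyStubDmEvenOrderThree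
import Summits.Langlands.Langlands.Theorems.QuarterDeficit1951IcosahedralSupplyStubDmUnramified
import Summits.Langlands.Langlands.Theorems.QuarterDeficit1951IcosahedralSupplyStubDmLocal1951

/-!
# Route `QuarterDeficit1951` (Langlands) — crux `IcosahedralSupply` (stmt-Langlands-15899), line `Sketch`

**The field side of the Doud–Moore supply, assembled.**  From the four landed field stubs
(`stub_dmGaloisDatum`: the roots `θ : Fin 5 → ℤ̄` of the totally real quintic
`x⁵ − x⁴ − 780x³ + 9911x² − 24208x + 15952` and the permutation representation `e₀ : Γ_ℚ → S₅` with
open kernel, complex conjugations acting trivially; `stub_dmUnramified`: inertia away from `1951`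
acts trivially; `stub_dmLocal1951`: inertia = decomposition image cyclic of order `5` above `1951`;
`stub_dmEvenOrderThree`: the image is even and contains an element of order `3`) the theorem
`doudMooreField` produces the projective Galois datum `e : Γ_ℚ → A₅` with open kernel, non-abelian
image, killing complex conjugations and the inertia away from `1951`, of type 3a at `1951`.
-/

set_option linter.dupNamespace false

noncomputable section

open scoped NumberField MatrixGroups
open Field IsDedekindDomain Polynomial
open Literature.NumberTheory.GaloisRepresentations Literature.NumberTheory.PAdicHodge

namespace Summit.Langlands.Langlands.Theorems.QuarterDeficit1951

/-- In `S₅`, an element of order `5` and a non-trivial element of order dividing `3` never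
commute (the centraliser of a `5`-cycle is the cyclic group it generates). [folklore] -/
theorem perm_five_not_comm_of_orderOf (g h : Equiv.Perm (Fin 5)) (hg : g ^ 5 = 1) (hg1 : g ≠ 1)
    (hh : h ^ 3 = 1) (hh1 : h ≠ 1) : g * h ≠ h * g := by
  revert g h
  set_option maxRecDepth 100000 in
  decide

/-- **The field side, assembled** (formerly the single stub `stub_doudMooreField`): the projective
Galois datum `e : Γ_ℚ → A₅` of the Doud–Moore field with open kernel, non-abelian image, killing
complex conjugations and the inertia away from `1951`, with inertia = decomposition image cyclic of
order `5` above `1951`. [cite: DoudMoore2006, §2 and §4] -/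
theorem doudMooreField :
    ∃ e : absoluteGaloisGroup ℚ →* alternatingGroup (Fin 5),
      IsOpen ((e.ker : Subgroup (absoluteGaloisGroup ℚ)) : Set (absoluteGaloisGroup ℚ)) ∧
      (∃ a b : absoluteGaloisGroup ℚ, e a * e b ≠ e b * e a) ∧
      (∀ (φ : ℚ →+* ℝ) (c : absoluteGaloisGroup ℚ), IsComplexConjugation φ c → e c = 1) ∧
      (∀ v : HeightOneSpectrum (𝓞 ℚ), v.residueCard ≠ 1951 →
        ∀ 𝔓 ∈ v.primesAbove, ∀ σ ∈ 𝔓.inertia (absoluteGaloisGroup ℚ), e σ = 1) ∧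
      (∀ v : HeightOneSpectrum (𝓞 ℚ), v.residueCard = 1951 → ∀ 𝔓 ∈ v.primesAbove,
        ∃ g : alternatingGroup (Fin 5), orderOf g = 5 ∧
          (𝔓.inertia (absoluteGaloisGroup ℚ)).map e = Subgroup.zpowers g ∧
          (𝔓.decompositionSubgroup (absoluteGaloisGroup ℚ)).map e = Subgroup.zpowers g) := by
  classical
  obtain ⟨θ, e₀, hroot, hinj, hall, he₀, hopen, hconj⟩ := stub_dmGaloisDatum
  have hunr := stub_dmUnramified θ hroot hinj hall
  have hloc := stub_dmLocal1951 θ hroot hinj hall e₀ he₀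
  obtain ⟨hsign, σ₃, hσ₃1, hσ₃⟩ := stub_dmEvenOrderThree θ hroot hinj hall e₀ he₀ hopen hunr hloc
  -- `e₀` lands in `A₅`
  have hmem : ∀ σ, e₀ σ ∈ alternatingGroup (Fin 5) := fun σ =>
    Equiv.Perm.mem_alternatingGroup.mpr (hsign σ)
  let e : absoluteGaloisGroup ℚ →* alternatingGroup (Fin 5) := e₀.codRestrict _ hmem
  have he : ∀ σ, ((e σ : alternatingGroup (Fin 5)) : Equiv.Perm (Fin 5)) = e₀ σ := fun σ => rfl
  have hker : e.ker = e₀.ker := by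
    ext σ
    rw [MonoidHom.mem_ker, MonoidHom.mem_ker, ← Subtype.coe_inj, he, OneMemClass.coe_one]
  -- `e₀ σ = 1` as soon as `σ` fixes every root
  have htriv : ∀ σ : absoluteGaloisGroup ℚ, (∀ i, σ • θ i = θ i) → e₀ σ = 1 := by
    intro σ hσ
    ext i
    exact congrArg Fin.val (hinj ((he₀ σ i).symm.trans (hσ i)))
  -- transport of `Subgroup.map` along the codomain restriction
  have hmap : ∀ (H : Subgroup (absoluteGaloisGroup ℚ)) (g : Equiv.Perm (Fin 5))
      (hg : g ∈ alternatingGroup (Fin 5)),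
      H.map e₀ = Subgroup.zpowers g → H.map e = Subgroup.zpowers ⟨g, hg⟩ := by
    intro H g hg hH
    apply Subgroup.map_injective (alternatingGroup (Fin 5)).subtype_injective
    rw [Subgroup.map_map, MonoidHom.map_zpowers]
    exact hH
  -- the place `(1951)`
  have hp : Nat.Prime 1951 := by norm_num
  set v₀ : HeightOneSpectrum (𝓞 ℚ) :=
    (Rat.HeightOneSpectrum.primesEquiv (R := 𝓞 ℚ)).symm ⟨1951, hp⟩ with hv₀def
  have hv₀ : ((1951 : ℕ) : 𝓞 ℚ) ∈ v₀.asIdeal :=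
    (Literature.NumberTheory.EllipticCurves.natCast_mem_asIdeal_iff_eq_primesEquiv_symm v₀ hp).mpr
      rfl
  have hv₀res : v₀.residueCard = 1951 := Rat.residueCard_eq_of_natCast_mem hp hv₀
  obtain ⟨𝔓₀, h𝔓₀⟩ := HeightOneSpectrum.primesAbove_nonempty v₀
  obtain ⟨g₅, hg₅, hI₅, -⟩ := hloc v₀ hv₀res 𝔓₀ h𝔓₀
  refine ⟨e, by rw [hker]; exact hopen, ?_, ?_, ?_, ?_⟩
  · -- non-abelian: an inertia element of order `5` and `σ₃` do not commute
    have hg₅mem : g₅ ∈ (𝔓₀.inertia (absoluteGaloisGroup ℚ)).map e₀ := by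
      rw [hI₅]; exact Subgroup.mem_zpowers g₅
    obtain ⟨σ₅, -, hσ₅⟩ := Subgroup.mem_map.mp hg₅mem
    refine ⟨σ₅, σ₃, fun h => ?_⟩
    have h' : e₀ σ₅ * e₀ σ₃ = e₀ σ₃ * e₀ σ₅ := by
      have := congrArg (fun x : alternatingGroup (Fin 5) => (x : Equiv.Perm (Fin 5))) h
      simpa only [Subgroup.coe_mul, he] using this
    rw [hσ₅] at h'
    refine perm_five_not_comm_of_orderOf g₅ (e₀ σ₃) (orderOf_dvd_iff_pow_eq_one.mp (by rw [hg₅]))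
      (fun h1 => ?_) hσ₃ hσ₃1 h'
    rw [h1, orderOf_one] at hg₅
    exact absurd hg₅ (by norm_num)
  · intro φ c hc
    apply Subtype.ext
    rw [he, OneMemClass.coe_one]
    exact htriv c (hconj φ c hc)
  · intro v hv 𝔓 h𝔓 σ hσ
    apply Subtype.ext
    rw [he, OneMemClass.coe_one]
    exact htriv σ (hunr v hv 𝔓 h𝔓 σ hσ)
  · intro v hv 𝔓 h𝔓
    obtain ⟨g, hg, hI, hD⟩ := hloc v hv 𝔓 h𝔓
    have hgA : g ∈ alternatingGroup (Fin 5) := by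
      have hgmem : g ∈ (𝔓.inertia (absoluteGaloisGroup ℚ)).map e₀ := by
        rw [hI]; exact Subgroup.mem_zpowers g
      obtain ⟨τ, -, rfl⟩ := Subgroup.mem_map.mp hgmem
      exact hmem τ
    refine ⟨⟨g, hgA⟩, ?_, hmap _ g hgA hI, hmap _ g hgA hD⟩
    rw [← Subgroup.orderOf_coe (a := (⟨g, hgA⟩ : alternatingGroup (Fin 5)))]
    exact hg

end Summit.Langlands.Langlands.Theorems.QuarterDeficit1951

end
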